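import Literature.IUT.HodgeTheaters.InitialThetaData
import Literature.IUT.HodgeTheaters.InitialThetaDataTotallyComplex
import Literature.IUT.HodgeTheaters.Labels
import Literature.NumberTheory.EllipticCurves.TateCurve.TateParameter
import Mathlib.NumberTheory.NumberField.InfinitePlace.TotallyRealComplex
import Mathlib.LinearAlgebra.Matrix.GeneralLinearGroup.Card
import Mathlib.GroupTheory.OrderOfElement
import HarnessLib

/-!
# [J-III] §3 «Fixing the Initial Theta Data à la Mochizuki» — Joshi's data (1)–(14), TYPED, with the dictionary to [IUTchI] Def. 3.1

Record file (D-0012) of the abc-iut cell, block E «type Joshi's construction, test vs S» (rung LADDER-ABC:A2.E;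
human ruling D-0078; seat abc-iut-E-t6, slot T-06 of `HOME/plan/E/ASSIGNMENTS.md`; inventory
`HOME/plan/E/t6/INVENTORY.tsv`). TAKES NO SIDE on [IUTchIII] Cor. 3.12, on the claims of K. Joshi, or on
S. Mochizuki's reports on them; typed ≠ proved; typed AS A CANDIDATE ≠ endorsed. SOURCE (own reading of the
cell's render `HOME/lit/renders/Joshi-arxiv-2401.13508/pNNNN.txt`; «p.N l.M» = line M of page file N): K. Joshi,
*Construction of Arithmetic Teichmüller Spaces III*, arXiv:2401.13508v4 («Preliminary version for comments»,
UNREFEREED) = [J-III], §3 pp. 27–30. Every statement [J-III] ASSERTS is a `def … : Prop` tagged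
`@[claim "Joshi2024ATS3" "disputed"]`, never an axiom / instance / `sorry` / Literature fact; the DATA is one
`structure` over REAL Mathlib carriers; what FOLLOWS from the typed signature is a proved `theorem`.

WHAT IS TYPED (numbering (1)–(14) = [J-III]'s; details and locators in the decl docstrings). §3.1 (1)–(4) p.27 +
§3.3 (9)–(14) p.28 = `InitialThetaData L L' Lbar C ℓ` over a number field `L` ([IUTchI] Def. 3.1's `F`), an
elliptic curve `C : WeierstrassCurve L` with `X = C ∖ {O}` (`E_F`, `X_F`), an algebraic closure `Lbar` (`F̄`), the
prime `ℓ` (`l`) and the field `L'` ([IUTchI]'s `K`). (1) «no real embeddings» = `IsTotallyComplex L` (WEAKER than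
(a) «`√−1 ∈ F`»); (2) «Strict Belyi Type» NOT CARRIED (no tree notion; [J-III] Thm. 2.4.1 (1) asserts it; slot
T-05); (4) `L_mod` = the tree's `fieldOfModuli C = ℚ(j_C)` REUSED BY NAME ([J-III] gives no definition; no model
`X_{L_mod}` is constructed); §3.2 (5)–(8) p.27: `VoddssMod`, `VoddSplitMod`, `VgoodMod`, `Voddss`, `Vgood` with TWO
READING FLAGS on (6) «bad, semi-stable reduction i.e. split multiplicative reduction» — typed as MULTIPLICATIVE
reduction at EVERY place of `L` over the prime of `L_mod` (the tree's reading of [IUTchI] (b)), the gloss «split»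
as the narrower `VoddSplitMod ⊆ VoddssMod` (PROVED) — and on (5) (non-archimedean only, yet §3.4 uses `V^arc`: the
ambient of (14) is the tree's `Val L'`); Lemma 3.2.1 = the claim `Lemma321` as printed, its formal content PROVED
(`mem_vgoodMod_iff`, `mem_vgoodMod_of_residueChar_two`, `mem_vgoodMod_of_exists`); (9) (10) (12) (13) (14) are
LITERALLY clauses (b) (c) (e) of the tree's `Literature.IUT.HodgeTheaters.InitialThetaData` (`IsGalois`,
`6`-torsion rational, `ImageContainsSL2`, `FixesTorsion`-fixed field, `Set.BijOn (toVMod …) V univ`); (11)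
`ℓ ≥ 5` prime, `ℓ ∤ [L : L_mod]` (⇔ (b) «degree prime to `l`», PROVED), `ℓ* = lStar ℓ`; §3.4 notation p.28–29;
§3.4.1 p.29 = the claims `TorsionPointOrderTwoL` («a point of exact order `2ℓ` over `L'_w`») and
`TateParameterRootTwoL` (over the tree's `TateCurve.tateParameter`; the `2l`-th root `q̳_v` the Θ-pilot values
need, abc-iut-c312-5 `Thm311RealTate` ERRATUM R7-C5-F1); §3.4.2 p.29 = `boundedDegreeField` (`L_{≤A}`), the claim
`Lemma3421` («`[L' : L] ≤ |GL₂(ℤ/ℓ)|`», DERIVABLE from (12)–(13) by infinite Galois theory — queued) and the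
numeric «`≪ ℓ⁴`» PROVED (`card_GL_two_lt`); §3.5 p.29–30: existence = [J-IV] Thm. 5.7.1 (slot T-28/29; Mochizuki
side [IUTchIV] Cor. 2.2 (ii), tree `exists_initialThetaData_of_conditions`) — pointer only; §6.1 Thm. 6.1.1
(descent to `L_mod`) is the sequel file `Joshi/HolomorphoidDescentLmod.lean`.

DICTIONARY (E3): Joshi `(L, L̄, C, X, L_mod, ℓ, ℓ*, L', V, V^{odd,ss}, V^good)` ↔ [IUTchI] Def. 3.1
`(F, F̄, E_F, X_F, F_mod, l, l^⋇, K, V̲, V^bad_mod ⊆ ·, V^good_mod ⊇ ·)` ↔ tree `Literature.IUT.HodgeTheaters.InitialThetaData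
F K Fbar E l P` / `Summit.ABC.IUTFork.Thm311.ThetaIndex` (`lstar`, `V`, `Vbad`). Joshi OMITS [IUTchI] (b)
semistability at all places, (c) «`l` prime to the residue characteristics of `V^bad_mod` and to `ord(q_v)`», and
(d) (e) (f) (orbicurves `C̲_K`, cusp `ε̲`, local types): the kernel map `InitialThetaData.ofMochizuki` (every Joshi
clause PROVED from the Mochizuki clause) has NO converse; `vbadMod_subset_voddssMod` (Mochizuki's CHOSEN
`V^bad_mod` ⊆ Joshi's ALL-such `V^{odd,ss}_{L_mod}`). Inputs of OUR side are imported BY NAME, never restated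
(DEFS-FREEZE). No new `Prop` fact. [claim: Joshi2024ATS3, status: disputed] [claim: Mochizuki2012, status: disputed]
-/


noncomputable section

open scoped Classical
open NumberField IsDedekindDomain
open Literature.IUT.HodgeTheaters hiding InitialThetaData

universe u v w

namespace Summit.ABC.IUTFork.Joshi.ATS3

/-! ## §3.2 (5)–(8) and Lemma 3.2.1: the sets of valuations attached to `C/L` -/
section Valuations

variable {L : Type u} [Field L] [NumberField L] (C : WeierstrassCurve L) [C.IsElliptic]

/-- `v ∈ V(L)^non` lies over `w ∈ V(L_mod)` (restriction of places `V(L) → V(L_mod)`, the tree's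
`Val.restrict`; [J-III] §3.2 (6)–(8) p.27 l.23–29 speak of primes of `L_mod` «at which `X` has … reduction», `X`
living over `L`). [claim: Joshi2024ATS3, status: disputed] -/
def LiesOverMod (v : FinitePlace L) (w : FinitePlace (fieldOfModuli C)) : Prop :=
  Val.restrict (fieldOfModuli C) (Val.non v) = Val.non w

/-- **[J-III] §3.2 (6), p.27 l.23–25: `V^{odd,ss}_{L_mod}`** — «the set of primes of `L_mod` with odd residue
characteristics at which `X` has bad, semi-stable reduction i.e. split multiplicative reduction». TYPED READING
(flagged): odd residue characteristic, and MULTIPLICATIVE («bad semi-stable») reduction of `C/L` at EVERY place of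
`L` over the prime; the gloss «split multiplicative» is `VoddSplitMod`. [claim: Joshi2024ATS3, status: disputed] -/
def VoddssMod : Set (FinitePlace (fieldOfModuli C)) :=
  {w | Odd (residueChar w) ∧
    ∀ v : FinitePlace L, LiesOverMod C v w → C.HasMultiplicativeReductionAt v.maximalIdeal}

/-- [J-III] §3.2 (6), the author's gloss «i.e. split multiplicative reduction» (p.27 l.25), as a separate set:
odd residue characteristic and SPLIT multiplicative reduction of `C/L` at every place of `L` over the prime
(narrower than `VoddssMod` in general: `voddSplitMod_subset`). [claim: Joshi2024ATS3, status: disputed] -/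
def VoddSplitMod : Set (FinitePlace (fieldOfModuli C)) :=
  {w | Odd (residueChar w) ∧
    ∀ v : FinitePlace L, LiesOverMod C v w → C.HasSplitMultiplicativeReductionAt v.maximalIdeal}

/-- **[J-III] §3.2 (7), p.27 l.26–28: `V^good_{L_mod} = V_{L_mod} − V^{odd,ss}_{L_mod}`** (inside the
NON-archimedean valuations, (5)). [claim: Joshi2024ATS3, status: disputed] -/
def VgoodMod : Set (FinitePlace (fieldOfModuli C)) := (VoddssMod C)ᶜ

/-- **[J-III] §3.2 (8), p.27 l.29** «one can also define similar subsets of valuations of `L`» (used in §3.4 as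
`V^{odd,ss}_L`, `V^{odd,ss}_{L'}`): for a number field `M ⊇ L`, the primes of `M` of odd residue characteristic at
which `C_M` has multiplicative («bad semi-stable») reduction. [claim: Joshi2024ATS3, status: disputed] -/
def Voddss (M : Type v) [Field M] [NumberField M] [Algebra L M] : Set (FinitePlace M) :=
  {w | Odd (residueChar w) ∧ (C.baseChange M).HasMultiplicativeReductionAt w.maximalIdeal}

/-- [J-III] §3.2 (8) / (7) for `M ⊇ L`: `V^good_M = V_M − V^{odd,ss}_M`. [claim: Joshi2024ATS3, status: disputed] -/
def Vgood (M : Type v) [Field M] [NumberField M] [Algebra L M] : Set (FinitePlace M) := (Voddss C M)ᶜ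

/-- The split-multiplicative gloss of (6) defines a SUBSET of the multiplicative reading (split multiplicative ⇒
multiplicative, the tree's `HasSplitMultiplicativeReductionAt.hasMultiplicativeReductionAt`). PROVED. [folklore] -/
theorem voddSplitMod_subset : VoddSplitMod C ⊆ VoddssMod C := fun _ hw =>
  ⟨hw.1, fun v hv => (hw.2 v hv).hasMultiplicativeReductionAt⟩

/-- **[J-III] Lemma 3.2.1, p.27 l.31–37** («immediate from the definitions»): «(1) `w ∈ V^good_{L_mod}` iff `w | 2` or
`X` has good reduction at `w` or has bad additive reduction at `w`. (2) For any `w | 2` in `V^good_{L_mod}`, `X` can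
have good or bad (additive or multiplicative) reduction at `w`.» TYPED as printed («`w | 2`» = residue characteristic
`2`; reduction «at `w`» read at every place of `L` over `w`, as in (6)); (2) asserts nothing beyond
`mem_vgoodMod_of_residueChar_two`. READING NOTE: the «only if» half is not a formal consequence of (6)–(7) (no
semistability is assumed, so places over one `w` may have mixed types; under the split gloss odd NON-split
multiplicative primes are a fourth case); the formal content is `mem_vgoodMod_iff`. Never asserted. [claim: Joshi2024ATS3, status: disputed] -/
@[claim "Joshi2024ATS3" "disputed"]
def Lemma321 : Prop :=
  ∀ w : FinitePlace (fieldOfModuli C), w ∈ VgoodMod C ↔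
    residueChar w = 2 ∨ (∀ v : FinitePlace L, LiesOverMod C v w → C.HasGoodReductionAt v.maximalIdeal) ∨
      (∀ v : FinitePlace L, LiesOverMod C v w → C.HasAdditiveReductionAt v.maximalIdeal)

/-- The definitional content of Lemma 3.2.1 (1): `w ∈ V^good_{L_mod}` iff NOT (odd residue characteristic and
multiplicative reduction at every place of `L` over `w`). PROVED (by definition). [folklore] -/
theorem mem_vgoodMod_iff (w : FinitePlace (fieldOfModuli C)) :
    w ∈ VgoodMod C ↔ ¬ (Odd (residueChar w) ∧
      ∀ v : FinitePlace L, LiesOverMod C v w → C.HasMultiplicativeReductionAt v.maximalIdeal) :=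
  Iff.rfl

/-- Lemma 3.2.1, the case «`w | 2`»: a prime of residue characteristic `2` lies in `V^good_{L_mod}` whatever the
reduction of `X` there (p.27 l.35–37). PROVED. [folklore] -/
theorem mem_vgoodMod_of_residueChar_two (w : FinitePlace (fieldOfModuli C)) (hw : residueChar w = 2) :
    w ∈ VgoodMod C := fun h => by
  have h2 : Odd (2 : ℕ) := hw ▸ h.1
  exact (Nat.not_odd_iff_even.mpr even_two) h2

/-- Lemma 3.2.1, the «if» half for good / additive reduction: if SOME place of `L` over `w` has good or additive
reduction, then `w ∈ V^good_{L_mod}` (local trichotomy: good / additive exclude multiplicative, the tree's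
`LocalReduction` API). PROVED. [folklore] -/
theorem mem_vgoodMod_of_exists (w : FinitePlace (fieldOfModuli C)) (v : FinitePlace L) (hv : LiesOverMod C v w)
    (h : C.HasGoodReductionAt v.maximalIdeal ∨ C.HasAdditiveReductionAt v.maximalIdeal) :
    w ∈ VgoodMod C := fun hw =>
  h.elim (fun hg => hg.not_hasMultiplicativeReductionAt (hw.2 v hv))
    (fun ha => ha.not_hasMultiplicativeReductionAt (hw.2 v hv))

end Valuations

/-! ## §3.1 + §3.3: Joshi's Initial Theta Data -/
section Data

variable (L : Type u) (L' : Type v) (Lbar : Type w) [Field L] [NumberField L] [Field L'] [NumberField L']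
  [Algebra L L'] [Field Lbar] [Algebra L Lbar] [Algebra L' Lbar] (C : WeierstrassCurve L) [C.IsElliptic] (ℓ : ℕ)

/-- **[J-III] §3.1 «Basic Hypotheses» (1)–(4), p.27 l.11–19, + §3.3 «Initial Theta-data» (9)–(14), p.28 l.1–12**
(«these assumptions essentially correspond to fixing the Initial Theta Data in [IUTchI]», p.27 l.9–10): ONE hypothesis
structure over the carriers `L`, `L'`, `Lbar`, the elliptic curve `C/L` (`X = C ∖ {O}`) and the prime `ℓ`; one field per
printed clause. NOT CARRIED: «Strict Belyi Type» in (2) ([J-III] Thm. 2.4.1 (1); no tree notion). Compare the tree's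
`Literature.IUT.HodgeTheaters.InitialThetaData` via `InitialThetaData.ofMochizuki`. A DEFINITION; nothing is asserted. [claim: Joshi2024ATS3, status: disputed] -/
structure InitialThetaData where
  /-- (1) «`L/ℚ` is a number field such that `L` has no real embeddings» (every infinite place is complex). -/
  isTotallyComplex : IsTotallyComplex L
  /-- (3) «Fix an algebraic closure `L̄` of `L` and write `G_L = Gal(L̄/L)`» (`G_L` is `Lbar ≃ₐ[L] Lbar`). -/
  [isAlgClosure : IsAlgClosure L Lbar]
  /-- (13) `L' ⊆ L̄` is an extension of `L` inside `L̄`: the structure maps `L → L' → L̄` and `L → L̄` agree. -/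
  [isScalarTower : IsScalarTower L L' Lbar]
  /-- (9) «`L/L_mod` is a Galois extension» (`L_mod = fieldOfModuli C`, (4)). -/
  isGalois_fieldOfModuli : IsGalois (fieldOfModuli C) L
  /-- (10) «The field `L` contains all points of order `2·3 = 6` of `C/L̄`, i.e. `L(C[6](L̄)) = L`»: every
  `L̄`-point killed by `6` comes from an `L`-point. -/
  torsion_six_rational : ∀ P : GeomPoints Lbar C, (6 : ℤ) • P = 0 →
    P ∈ Set.range (WeierstrassCurve.Affine.Point.baseChange (W' := C.toAffine) L Lbar)
  /-- (11) «Let `ℓ ≥ 5` be a prime number …» — primality … -/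
  prime : ℓ.Prime
  /-- (11) … «`ℓ ≥ 5`» … -/
  five_le : 5 ≤ ℓ
  /-- (11) … «and assume that `ℓ` does not divide the degree `[L : L_mod]` of `L/L_mod`». -/
  not_dvd_finrank : ¬ ℓ ∣ Module.finrank (fieldOfModuli C) L
  /-- (12) «the image of the mod `ℓ` representation `ρ_{C/L;ℓ} : G_L → Aut_{ℤ/ℓ}(C[ℤ/ℓ]) = GL₂(ℤ/ℓ)` contains
  `SL₂(ℤ/ℓ)`» (the tree's basis form, basis-independent). -/
  imageContainsSL2 : ImageContainsSL2 Lbar C ℓ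
  /-- (13) «Let `L'` be the fixed field of the kernel of the homomorphism `ρ_{C/L;ℓ} : G_L → GL₂(ℤ/ℓ)`»: the
  image of `L'` in `L̄` is exactly the fixed field of the automorphisms acting trivially on `C[ℓ](L̄)`. -/
  range_iff : ∀ x : Lbar, x ∈ Set.range (algebraMap L' Lbar) ↔
    ∀ σ : Lbar ≃ₐ[L] Lbar, FixesTorsion C ℓ σ → σ x = x
  /-- (14) «Fix a bijection `V_{L_mod} ≃ V ⊂ V_{L'}`»: the subset `V` … -/
  V : Set (Val L')
  /-- (14) … on which the restriction of places `V(L') → V(L) → V(L_mod)` (the tree's `toVMod`) is a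
  bijection onto `V(L_mod)`. -/
  V_bijOn : Set.BijOn (toVMod L L' C) V Set.univ

end Data

namespace InitialThetaData

variable {L : Type u} {L' : Type v} {Lbar : Type w} [Field L] [NumberField L] [Field L'] [NumberField L']
  [Algebra L L'] [Field Lbar] [Algebra L Lbar] [Algebra L' Lbar] {C : WeierstrassCurve L} [C.IsElliptic]
  {ℓ : ℕ} (D : InitialThetaData L L' Lbar C ℓ)

/-! ### (4), (11): `L_mod`, `ℓ*`, and the two arithmetic rephrasings -/

/-- (4) «`L_mod` = the field of moduli of `X/L`», p.27 l.17 — the tree's `fieldOfModuli C = ℚ(j_C) ⊆ L`,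
REUSED BY NAME. [claim: Joshi2024ATS3, status: disputed] -/
abbrev Lmod (_D : InitialThetaData L L' Lbar C ℓ) : IntermediateField ℚ L := fieldOfModuli C

/-- (11) «write `ℓ* = (ℓ − 1)/2`», p.28 l.5–6 — the tree's `lStar ℓ` ([IUTchI] §0 `l^⋇`), REUSED BY NAME.
[claim: Joshi2024ATS3, status: disputed] -/
abbrev lstar (_D : InitialThetaData L L' Lbar C ℓ) : ℕ := lStar ℓ

/-- `ℓ* = (ℓ − 1)/2` on the nose. [folklore] -/
theorem lstar_eq : D.lstar = (ℓ - 1) / 2 := rfl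

/-- `ℓ* ≥ 2` (from `ℓ ≥ 5`) — the field `two_le_lstar` of the tree's index skeleton `Thm311.ThetaIndex`. PROVED. [folklore] -/
theorem two_le_lstar : 2 ≤ D.lstar := by
  have h := D.five_le
  change 2 ≤ (ℓ - 1) / 2
  omega

/-- (11) in [IUTchI] Def. 3.1 (b)'s wording: «`F/F_mod` … of degree prime to `l`» — for a prime `ℓ`,
«`ℓ ∤ [L : L_mod]`» is the same as «`[L : L_mod]` coprime to `ℓ`». PROVED. [folklore] -/
theorem finrank_coprime (D : InitialThetaData L L' Lbar C ℓ) : (Module.finrank (fieldOfModuli C) L).Coprime ℓ :=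
  ((Nat.Prime.coprime_iff_not_dvd D.prime).mpr D.not_dvd_finrank).symm

/-! ### (14) and §3.4: the chosen valuations `V` and their subsets -/

/-- The inverse bijection `V_{L_mod} ⥲ V`, `v ↦ v̲` of (14) (by choice; cf. Thm. 6.1.1's «“index” set identified
by `V ≃ V_{L_mod}`», p.43 l.29). [claim: Joshi2024ATS3, status: disputed] -/
def underline (v : Val (fieldOfModuli C)) : Val L' := (D.V_bijOn.surjOn (Set.mem_univ v)).choose

/-- `v̲ ∈ V`. PROVED. [folklore] -/
theorem underline_mem (v : Val (fieldOfModuli C)) : D.underline v ∈ D.V :=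
  (D.V_bijOn.surjOn (Set.mem_univ v)).choose_spec.1

/-- `v̲` lies over `v`. PROVED. [folklore] -/
theorem toVMod_underline (v : Val (fieldOfModuli C)) : toVMod L L' C (D.underline v) = v :=
  (D.V_bijOn.surjOn (Set.mem_univ v)).choose_spec.2

/-- `w = v̲` for the `v` under `w`, whenever `w ∈ V` (injectivity half of (14)). PROVED. [folklore] -/
theorem underline_toVMod {w : Val L'} (hw : w ∈ D.V) : D.underline (toVMod L L' C w) = w :=
  D.V_bijOn.injOn (D.underline_mem _) hw (D.toVMod_underline _)

/-- §3.4, p.28 l.23–24: `V^non = V ∩ V^non_{L'}`. [claim: Joshi2024ATS3, status: disputed] -/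
def Vnon : Set (Val L') := {w ∈ D.V | w.IsNon}

/-- §3.4, p.28 l.25–27: `V^arc = V ∩ V^arc_{L'}` (READING FLAG: (5) declared `V_L` non-archimedean only, yet §3.4
intersects `V` with the archimedean places — so `V ⊂ Val L'` ranges over ALL places). [claim: Joshi2024ATS3, status: disputed] -/
def Varc : Set (Val L') := {w ∈ D.V | w.IsArc}

/-- §3.4, p.28 l.31–33: `V^{odd,ss} = V ∩ V^{odd,ss}_{L'}`. [claim: Joshi2024ATS3, status: disputed] -/
def Voddss : Set (Val L') := {w ∈ D.V | ∃ w₀ : FinitePlace L', w = Val.non w₀ ∧ w₀ ∈ ATS3.Voddss C L'}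

/-- §3.4, p.28 l.28–30: `V^good = V ∩ V^good_{L'}` (non-archimedean members of `V` outside `V^{odd,ss}_{L'}`).
[claim: Joshi2024ATS3, status: disputed] -/
def Vgood : Set (Val L') := {w ∈ D.V | ∃ w₀ : FinitePlace L', w = Val.non w₀ ∧ w₀ ∈ ATS3.Vgood C L'}

/-- §3.4, p.29 l.1–2: for a rational prime `p`, `V_p = {w ∈ V : w | p}` (residue characteristic `p`).
[claim: Joshi2024ATS3, status: disputed] -/
def Vp (p : ℕ) : Set (Val L') := {w ∈ D.V | ∃ w₀ : FinitePlace L', w = Val.non w₀ ∧ residueChar w₀ = p}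

/-- §3.4, p.29 l.3–5: `V^good_p = {w ∈ V^good : w | p}`. [claim: Joshi2024ATS3, status: disputed] -/
def VgoodP (p : ℕ) : Set (Val L') := D.Vgood ∩ D.Vp p

/-- §3.4, p.29 l.6–8: `V^{odd,ss}_p = {w ∈ V^{odd,ss} : w | p}`. [claim: Joshi2024ATS3, status: disputed] -/
def VoddssP (p : ℕ) : Set (Val L') := D.Voddss ∩ D.Vp p

/-- `V^{odd,ss} ⊆ V^non`. PROVED. [folklore] -/
theorem voddss_subset_vnon : D.Voddss ⊆ D.Vnon := by
  rintro w ⟨hw, w₀, rfl, -⟩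
  exact ⟨hw, rfl⟩

/-- `V^good` and `V^{odd,ss}` are disjoint. PROVED. [folklore] -/
theorem disjoint_vgood_voddss : Disjoint D.Vgood D.Voddss := by
  refine Set.disjoint_left.mpr ?_
  rintro w ⟨-, w₀, rfl, h₀⟩ ⟨-, w₁, h₁, h₁'⟩
  have : w₀ = w₁ := Sum.inr_injective h₁
  subst this
  exact h₀ h₁'

/-! ### §3.4.1 «Existence of local torsion points of order `2ℓ`» (claims) -/

/-- **[J-III] §3.4.1, p.29 l.9–16** («an important consequence of §3.1 and §3.3»; no proof printed): «Let
`w ∈ V^{odd,ss}` be a prime of `L'` lying over a prime `v ∈ V^{odd,ss}_L` of `L`. Then `C/L'_w` has a non-trivial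
point of exact order `2·ℓ` defined over `L'_w`, i.e. `C[2·ℓ](L'_w) ≠ 0`.» TYPED: a point of the base change of `C`
to the completion `L'_w` of additive order exactly `2ℓ`. This is the clause [IUTchI] uses as «`E[2l]` is
`K`-rational». Never asserted. [claim: Joshi2024ATS3, status: disputed] -/
@[claim "Joshi2024ATS3" "disputed"]
def TorsionPointOrderTwoL : Prop :=
  ∀ (w₀ : FinitePlace L') (v₀ : FinitePlace L), Val.non w₀ ∈ D.V → w₀ ∈ ATS3.Voddss C L' →
    v₀ ∈ ATS3.Voddss C L → Val.restrict L (Val.non w₀) = Val.non v₀ →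
      ∃ P : ((C.baseChange L').baseChange (w₀.maximalIdeal.adicCompletion L')).toAffine.Point,
        addOrderOf P = 2 * ℓ

/-- **[J-III] §3.4.1, p.29 l.17–19**: «In particular, if `w | v` for a prime `v | p` of `L`, then the Tate
parameter of `C/L_v` has a `2ℓ`th-root in `L'_w`.» TYPED over the tree's `tateParameter` (Silverman ATAEC V.5.3
(a): defined for `|j(C)|_v > 1`, a binder `hj`) and a POSITED continuous `L`-compatible map of completions
`ι : L_v → L'_w` (Mathlib's `LiesOver` binder style; the canonical one is meant). Never asserted.
[claim: Joshi2024ATS3, status: disputed] -/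
@[claim "Joshi2024ATS3" "disputed"]
def TateParameterRootTwoL : Prop :=
  ∀ (w₀ : FinitePlace L') (v₀ : FinitePlace L), Val.non w₀ ∈ D.V → w₀ ∈ ATS3.Voddss C L' →
    v₀ ∈ ATS3.Voddss C L → Val.restrict L (Val.non w₀) = Val.non v₀ →
    ∀ (ι : v₀.maximalIdeal.adicCompletion L →+* w₀.maximalIdeal.adicCompletion L'), Continuous ι →
      (∀ x : L, ι (algebraMap L _ x) = algebraMap L' _ (algebraMap L L' x)) →
      ∀ hj : 1 < ‖(C.map (algebraMap L (v₀.maximalIdeal.adicCompletion L))).j‖,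
        ∃ r : w₀.maximalIdeal.adicCompletion L',
          r ^ (2 * ℓ) = ι (Literature.NumberTheory.EllipticCurves.TateCurve.tateParameter
            (C.map (algebraMap L (v₀.maximalIdeal.adicCompletion L))) hj)

/-! ### §3.4.2 «Elementary bound»: `L_{≤A}` and Lemma 3.4.2.1 -/

/-- **[J-III] §3.4.2, p.29 l.24–28: `L_{≤A} ⊂ L̄`** — «the smallest subfield containing all finite extensions
`L'/L` of degrees `[L' : L] ≤ A`», as an intermediate field of `L̄/L` (the supremum of the finite intermediate
fields of degree `≤ A`). [claim: Joshi2024ATS3, status: disputed] -/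
def boundedDegreeField (L : Type u) (Lbar : Type w) [Field L] [Field Lbar] [Algebra L Lbar] (A : ℝ) :
    IntermediateField L Lbar :=
  ⨆ K ∈ {K : IntermediateField L Lbar | FiniteDimensional L K ∧ (Module.finrank L K : ℝ) ≤ A}, K

/-- A finite intermediate field of degree `≤ A` lies in `L_{≤A}`. PROVED. [folklore] -/
theorem le_boundedDegreeField {L : Type u} {Lbar : Type w} [Field L] [Field Lbar] [Algebra L Lbar] {A : ℝ}
    (K : IntermediateField L Lbar) (hK : FiniteDimensional L K) (hA : (Module.finrank L K : ℝ) ≤ A) :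
    K ≤ boundedDegreeField L Lbar A :=
  le_iSup₂ (f := fun (K : IntermediateField L Lbar) (_ : K ∈ {K : IntermediateField L Lbar |
    FiniteDimensional L K ∧ (Module.finrank L K : ℝ) ≤ A}) => K) K ⟨hK, hA⟩

/-- **[J-III] Lemma 3.4.2.1, p.29 l.24–36**: «Let `ℓ` be a fixed odd prime … as `C/L` varies over `M_{1,1}(L)` the
data §3.1 for `C/L` provide a family of finite extensions `L'/L` (`L'` the fixed field of `ker(ρ_{C/L;ℓ})`) which
are contained in `L_{≤A}` with `A = |GL₂(ℤ/ℓ)| ≪ ℓ⁴`.» (proof printed: «`Gal(L'/L) ⊂ GL₂(ℤ/ℓ)`»). TYPED for the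
data at hand: `L'/L` is finite of degree `≤ |GL₂(ℤ/ℓ)|` (whence its image lies in `L_{≤A}`:
`le_boundedDegreeField`). DERIVABLE from (12)–(13) by infinite Galois theory — not yet discharged; the numeric
«`≪ ℓ⁴`» is `card_GL_two_lt`. Never asserted. [claim: Joshi2024ATS3, status: disputed] -/
@[claim "Joshi2024ATS3" "disputed"]
def Lemma3421 : Prop :=
  FiniteDimensional L L' ∧ Module.finrank L L' ≤ Nat.card (GL (Fin 2) (ZMod ℓ))

/-- «`|GL₂(ℤ/ℓ)| ≪ ℓ⁴`» (p.29 l.32, l.36): `|GL₂(𝔽_ℓ)| = (ℓ² − 1)(ℓ² − ℓ) < ℓ⁴` for a prime `ℓ` (Mathlib's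
`Matrix.card_GL_field`). PROVED. [folklore] -/
theorem card_GL_two_lt (D : InitialThetaData L L' Lbar C ℓ) : Nat.card (GL (Fin 2) (ZMod ℓ)) < ℓ ^ 4 := by
  haveI : Fact ℓ.Prime := ⟨D.prime⟩
  have hℓ : 0 < ℓ := D.prime.pos
  rw [Matrix.card_GL_field, Fin.prod_univ_two, ZMod.card]
  simp only [Fin.val_zero, pow_zero, Fin.val_one, pow_one]
  have h1 : ℓ ^ 2 - 1 < ℓ ^ 2 := Nat.sub_lt (by positivity) one_pos
  have h2 : ℓ ^ 2 - ℓ ≤ ℓ ^ 2 := Nat.sub_le _ _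
  calc (ℓ ^ 2 - 1) * (ℓ ^ 2 - ℓ) ≤ (ℓ ^ 2 - 1) * ℓ ^ 2 := Nat.mul_le_mul_left _ h2
    _ < ℓ ^ 2 * ℓ ^ 2 := Nat.mul_lt_mul_of_pos_right h1 (by positivity)
    _ = ℓ ^ 4 := by ring

/-! ### The E3 dictionary: [IUTchI] Def. 3.1 data ⟹ Joshi's §3.1 + §3.3 data -/

/-- **DICTIONARY MAP.** A collection of initial Θ-data in the sense of [IUTchI] Def. 3.1 as typed in the tree
(`Literature.IUT.HodgeTheaters.InitialThetaData F K Fbar E l P`, abc-iut-L5-t2) IS a collection of Joshi's data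
(§3.1 + §3.3) for `L := F`, `L' := K`, `L̄ := F̄`, `C := E_F`, `ℓ := l`: every Joshi clause is a Mochizuki clause,
except (1) «no real embeddings», which FOLLOWS from (a) «`√−1 ∈ F`» (tree: `isTotallyComplex_F`), and (11)
«`ℓ ∤ [L:L_mod]`» = (b) «degree prime to `l`». The clauses Joshi omits ((b) semistability, (c) `l ∤` residue
characteristics / `ord q_v`, (d)–(f)) are dropped; there is no converse map. PROVED (a definition whose proof
obligations are discharged). [claim: Joshi2024ATS3, status: disputed] [claim: Mochizuki2012, status: disputed] -/
def ofMochizuki {P : BadPlacePredicates L'}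
    (D : Literature.IUT.HodgeTheaters.InitialThetaData L L' Lbar C ℓ P) : InitialThetaData L L' Lbar C ℓ :=
  letI := D.isAlgClosure
  letI := D.isScalarTower
  { isTotallyComplex := D.isTotallyComplex_F
    isGalois_fieldOfModuli := D.isGalois_fieldOfModuli
    torsion_six_rational := D.torsion_six_rational
    prime := D.l_prime
    five_le := D.five_le_l
    not_dvd_finrank := fun h => D.l_prime.ne_one (Nat.Coprime.eq_one_of_dvd D.finrank_coprime.symm h)
    imageContainsSL2 := D.imageContainsSL2
    range_iff := D.range_K_iff
    V := D.V
    V_bijOn := D.V_bijOn }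

/-- **(6) vs [IUTchI] (b).** Mochizuki's CHOSEN `V^bad_mod` («nonempty set of nonarchimedean valuations of `F_mod` of odd
residue characteristic such that `X_F` has bad [i.e., multiplicative] reduction at the elements of `V(F)` that lie over
`V^bad_mod`») is a SUBSET of Joshi's `V^{odd,ss}_{L_mod}` (= ALL such primes, multiplicative reading). PROVED.
[claim: Mochizuki2012, status: disputed] -/
theorem vbadMod_subset_voddssMod {P : BadPlacePredicates L'}
    (D : Literature.IUT.HodgeTheaters.InitialThetaData L L' Lbar C ℓ P) : D.VbadMod ⊆ VoddssMod C := by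
  intro w hw
  refine ⟨D.VbadMod_odd w hw, fun v hv => D.multiplicative_over_VbadMod v ?_⟩
  rw [LiesOverMod] at hv
  exact hv ▸ Set.mem_image_of_mem _ hw

/-- Dually, Joshi's `V^good_{L_mod}` lies inside Mochizuki's `V^good_mod` (restricted to finite places). PROVED.
[claim: Mochizuki2012, status: disputed] -/
theorem vgoodMod_subset_vgoodMod {P : BadPlacePredicates L'}
    (D : Literature.IUT.HodgeTheaters.InitialThetaData L L' Lbar C ℓ P) :
    Val.non '' VgoodMod C ⊆ D.VgoodMod := by
  rintro _ ⟨w, hw, rfl⟩ ⟨w', hw', h⟩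
  have : w' = w := Sum.inr_injective h
  subst this
  exact hw (vbadMod_subset_voddssMod D hw')

end InitialThetaData


end Summit.ABC.IUTFork.Joshi.ATS3

end
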